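import Summits.ValiantsHypothesis.ValiantsHypothesis.Theorems.LacunarySymmetroidMatrixDescartesIndexOneInflection

/-!
# `MatrixDescartes` (stmt-ValiantsHypothesis-18050) — pivot column at index one: THE DENT DISCRIMINANT IS A VARIANCE GAP
# `𝔖[N, D] = N²·𝕍(D) − D²·𝕍(N)`, `𝕍(f) := θ²f·f − (θf)²` (`θ = X·d/dX`) has nonnegative coefficients for every posynomial; the `m = 1` cell

HONEST FRAMING.  Cell `pub-symmetroid`, seat `val-sym-mdr-p2` (gen 23); helper file `--supports` the crux
`Theses.LacunarySymmetroid.MatrixDescartes` (OPEN), NO closure claim.  Companion of this seat's `…IndexOneInflection` (p677643: for index-one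
pivot pencils `Z₊(det F) ≤ Z₊(𝔖[N, det 𝔻]) + 2`, `N = wᵀadj(𝔻)w`).  Nothing here bears on `MatrixDescartes` in its window, on `stub_twoSided`, on
`DoorA26` / `DoorA34`, the census registers, or `VP ≠ VNP`.

CONTENT (the cleanest form of the located INFLECTION LAW «Z₊(𝔖) ≤ 2(m−1)(L−1)», seat memo DENT-CENSUS.md §6).
* `coeff_euler` : `coeff (X·f′) n = n·coeff f n` (Euler operator `θ`).
* `dent_eq_varianceGap`: **`𝔖[N, D] = N²·𝕍(D) − D²·𝕍(N)`**, `𝕍(f) := θ(θf)·f − (θf)·(θf)`; on `(0,∞)`, `𝕍(f)/f² = θ² log f` is the VARIANCE of the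
  exponent under the weights `{f_α x^α}`, so `𝔖 /(N D)² = Var_D(x) − Var_N(x)`: the positive zeros of the dent discriminant of an index-one pencil are
  the points where the exponent-variance of `det 𝔻` (a posynomial: squared Gram minors) equals that of the principal-minor posynomial `N`.
* `coeff_eulerVariance` / `coeff_eulerVariance_eq_half_sum_sq`: `coeff (𝕍 f) s = ½ ∑_{i+j=s} (i − j)² fᵢ fⱼ`; hence
  **`coeff_eulerVariance_nonneg`**: a polynomial with nonnegative coefficients has `𝕍(f)` with nonnegative coefficients, and
  `posRootCount_eq_zero_of_coeff_nonneg`: such polynomials have no positive root.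
* **`posRootCount_dent_const`** (the `m = 1` CELL of the inflection law): `N = C c` constant, `D` with nonnegative coefficients ⇒ `Z₊(𝔖[N, D]) = 0`;
  with p677643 this is `Z₊(D − X^e·c) ≤ 2` for every posynomial `D` — INFL(1, L) = 0 — by the dent calculus alone.

[folklore] Coefficient bookkeeping over Mathlib (`Polynomial.coeff_mul`, `Finset.Nat.sum_antidiagonal_swap`).
Axioms `propext`, `Classical.choice`, `Quot.sound`.
-/

set_option linter.dupNamespace false

namespace Summit.ValiantsHypothesis.ValiantsHypothesis.Theorems.LacunarySymmetroidMatrixDescartes.SecularRolle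

open Polynomial Finset
open scoped BigOperators

/-- The dent discriminant (local notation, as in `…IndexOneInflection`). -/
local notation3 (prettyPrint := false) "𝔖[" N ", " D "]" =>
  (X : ℝ[X]) * (twistedWronskian 0 N D * derivative (N * D) - derivative (twistedWronskian 0 N D) * (N * D))

/-- The Euler variance form `𝕍(f) = θ(θ f)·f − (θ f)²`, `θ = X·d/dX` (local notation). -/
local notation3 (prettyPrint := false) "𝕍[" f "]" =>
  ((X : ℝ[X]) * derivative ((X : ℝ[X]) * derivative f) * f - ((X : ℝ[X]) * derivative f) * ((X : ℝ[X]) * derivative f))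

/-! ### §1. The variance-gap identity -/

/-- **`𝔖[N, D] = N²·𝕍(D) − D²·𝕍(N)`.** [folklore] -/
theorem dent_eq_varianceGap (N D : ℝ[X]) : 𝔖[N, D] = N * N * 𝕍[D] - D * D * 𝕍[N] := by
  unfold twistedWronskian
  simp only [Nat.cast_zero, map_zero, zero_mul, zero_add, derivative_sub, derivative_mul, derivative_X, one_mul]
  ring

/-! ### §2. Coefficients of the Euler variance form -/

/-- `coeff (X·f′) n = n · coeff f n`. [folklore] -/
theorem coeff_euler (f : ℝ[X]) (n : ℕ) : ((X : ℝ[X]) * derivative f).coeff n = (n : ℝ) * f.coeff n := by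
  rcases n with _ | n
  · simp
  · rw [coeff_X_mul, coeff_derivative, Nat.cast_succ]; ring

/-- `coeff (X·(X·f′)′) n = n² · coeff f n`. [folklore] -/
theorem coeff_euler_euler (f : ℝ[X]) (n : ℕ) :
    ((X : ℝ[X]) * derivative ((X : ℝ[X]) * derivative f)).coeff n = (n : ℝ) * (n : ℝ) * f.coeff n := by
  rw [coeff_euler, coeff_euler, mul_assoc]

/-- `coeff (𝕍 f) s = ∑_{i+j=s} (i² − i j) fᵢ fⱼ`. [folklore] -/
theorem coeff_eulerVariance (f : ℝ[X]) (s : ℕ) :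
    (𝕍[f]).coeff s = ∑ p ∈ antidiagonal s, ((p.1 : ℝ) * (p.1 : ℝ) - (p.1 : ℝ) * (p.2 : ℝ)) * (f.coeff p.1 * f.coeff p.2) := by
  rw [coeff_sub, coeff_mul, coeff_mul, ← Finset.sum_sub_distrib]
  refine Finset.sum_congr rfl fun p _ => ?_
  rw [coeff_euler_euler, coeff_euler, coeff_euler]
  ring

/-- `coeff (𝕍 f) s = ½ ∑_{i+j=s} (i − j)² fᵢ fⱼ` (symmetrisation over the antidiagonal). [folklore] -/
theorem coeff_eulerVariance_eq_half_sum_sq (f : ℝ[X]) (s : ℕ) :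
    (𝕍[f]).coeff s = (1 / 2) * ∑ p ∈ antidiagonal s, ((p.1 : ℝ) - (p.2 : ℝ)) ^ 2 * (f.coeff p.1 * f.coeff p.2) := by
  rw [coeff_eulerVariance]
  have hswap : ∑ p ∈ antidiagonal s, ((p.1 : ℝ) * (p.1 : ℝ) - (p.1 : ℝ) * (p.2 : ℝ)) * (f.coeff p.1 * f.coeff p.2)
      = ∑ p ∈ antidiagonal s, ((p.2 : ℝ) * (p.2 : ℝ) - (p.2 : ℝ) * (p.1 : ℝ)) * (f.coeff p.2 * f.coeff p.1) := by
    rw [← Finset.Nat.sum_antidiagonal_swap]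
    rfl
  have h2 : (∑ p ∈ antidiagonal s, ((p.1 : ℝ) * (p.1 : ℝ) - (p.1 : ℝ) * (p.2 : ℝ)) * (f.coeff p.1 * f.coeff p.2))
      + ∑ p ∈ antidiagonal s, ((p.2 : ℝ) * (p.2 : ℝ) - (p.2 : ℝ) * (p.1 : ℝ)) * (f.coeff p.2 * f.coeff p.1)
      = ∑ p ∈ antidiagonal s, ((p.1 : ℝ) - (p.2 : ℝ)) ^ 2 * (f.coeff p.1 * f.coeff p.2) := by
    rw [← Finset.sum_add_distrib]
    exact Finset.sum_congr rfl fun p _ => by ring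
  rw [← hswap] at h2
  linarith

/-- **A polynomial with nonnegative coefficients has an Euler variance form with nonnegative coefficients.** [folklore] -/
theorem coeff_eulerVariance_nonneg {f : ℝ[X]} (hf : ∀ n, 0 ≤ f.coeff n) (s : ℕ) : 0 ≤ (𝕍[f]).coeff s := by
  rw [coeff_eulerVariance_eq_half_sum_sq]
  refine mul_nonneg (by norm_num) (Finset.sum_nonneg fun p _ => ?_)
  exact mul_nonneg (sq_nonneg _) (mul_nonneg (hf _) (hf _))

/-- A polynomial with nonnegative coefficients is nonnegative on `[0, ∞)`. [folklore] -/
theorem eval_nonneg_of_coeff_nonneg {f : ℝ[X]} (hf : ∀ n, 0 ≤ f.coeff n) {x : ℝ} (hx : 0 ≤ x) : 0 ≤ f.eval x := by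
  rw [eval_eq_sum_range]
  exact Finset.sum_nonneg fun n _ => mul_nonneg (hf n) (pow_nonneg hx n)

/-- A nonzero polynomial with nonnegative coefficients is positive on `(0, ∞)`. [folklore] -/
theorem eval_pos_of_coeff_nonneg {f : ℝ[X]} (hf : ∀ n, 0 ≤ f.coeff n) (h0 : f ≠ 0) {x : ℝ} (hx : 0 < x) :
    0 < f.eval x := by
  rw [eval_eq_sum_range]
  obtain ⟨k, hk⟩ : ∃ k, f.coeff k ≠ 0 := by
    by_contra h
    exact h0 (Polynomial.ext fun n => by simpa using not_exists.mp h n)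
  have hkdeg : k < f.natDegree + 1 := Nat.lt_succ_of_le (le_natDegree_of_ne_zero hk)
  have hkpos : 0 < f.coeff k * x ^ k := mul_pos (lt_of_le_of_ne (hf k) (Ne.symm hk)) (pow_pos hx k)
  calc (0 : ℝ) < f.coeff k * x ^ k := hkpos
    _ ≤ ∑ n ∈ range (f.natDegree + 1), f.coeff n * x ^ n :=
        Finset.single_le_sum (f := fun n => f.coeff n * x ^ n) (fun n _ => mul_nonneg (hf n) (pow_nonneg hx.le n))
          (Finset.mem_range.mpr hkdeg)

/-- **No positive roots for nonnegative coefficients**: `Z₊(f) = 0`. [folklore] -/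
theorem posRootCount_eq_zero_of_coeff_nonneg {f : ℝ[X]} (hf : ∀ n, 0 ≤ f.coeff n) : posRootCount f = 0 := by
  unfold posRootCount
  rcases eq_or_ne f 0 with h0 | h0
  · simp [h0]
  rw [Finset.card_eq_zero, Finset.filter_eq_empty_iff]
  intro x hx hxpos
  rw [Multiset.mem_toFinset, mem_roots h0, IsRoot.def] at hx
  exact absurd hx (ne_of_gt (eval_pos_of_coeff_nonneg hf h0 hxpos))

/-! ### §3. The `m = 1` cell of the inflection law -/

/-- For a constant `N = C c` the variance form vanishes: `𝕍(C c) = 0`. [folklore] -/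
theorem eulerVariance_C (c : ℝ) : 𝕍[Polynomial.C c] = 0 := by
  simp

/-- **THE `m = 1` CELL: `Z₊(𝔖[C c, D]) = 0` for every polynomial `D` with nonnegative coefficients** (a `1 × 1` PSD skeleton has
`N = wᵀadj(𝔻)w = w²` constant and `det 𝔻` a posynomial): with p677643, `Z₊(D − X^e·C c) ≤ 2` for every posynomial `D` and every `e`
— INFL(1, L) = 0, by the dent calculus alone. [folklore] -/
theorem posRootCount_dent_const (c : ℝ) {D : ℝ[X]} (hD : ∀ n, 0 ≤ D.coeff n) :
    posRootCount 𝔖[Polynomial.C c, D] = 0 := by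
  rw [dent_eq_varianceGap, eulerVariance_C, mul_zero, sub_zero]
  refine posRootCount_eq_zero_of_coeff_nonneg fun n => ?_
  rw [← map_mul, coeff_C_mul]
  exact mul_nonneg (mul_self_nonneg c) (coeff_eulerVariance_nonneg hD n)

/-- The same with the secular Rolle bound spelled out: posynomial `D` without positive zero ⇒ `Z₊(D − X^e · C c) ≤ 2` for every `c ≠ 0`, `e`
(for `c ≤ 0` or one-sided `e` the true count is smaller; this is the uniform `m = 1` instance of p677643). [folklore] -/
theorem posRootCount_sub_X_pow_C_le_two (e : ℕ) {c : ℝ} (hc : c ≠ 0) {D : ℝ[X]} (hD : ∀ n, 0 ≤ D.coeff n) (hD0 : D ≠ 0) :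
    posRootCount (D - X ^ e * Polynomial.C c) ≤ 2 := by
  have hDx : ∀ x : ℝ, 0 < x → D.eval x ≠ 0 := fun x hx => ne_of_gt (eval_pos_of_coeff_nonneg hD hD0 hx)
  have hN : ∀ x : ℝ, 0 < x → (Polynomial.C c).eval x ≠ 0 := fun x _ => by simpa using hc
  have h := posRootCount_sub_X_pow_mul_le_dent_add_two e (Polynomial.C c) D hN hDx
  rw [posRootCount_dent_const c hD] at h
  simpa using h

end Summit.ValiantsHypothesis.ValiantsHypothesis.Theorems.LacunarySymmetroidMatrixDescartes.SecularRolle
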